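import Literature.NumberTheory.Automorphic.UnipotentTateDomain
import Literature.NumberTheory.Automorphic.GLnIwasawaIntegration
import Literature.Topology.Metrizable.LocallyCompactPolish
import HarnessLib

/-!
# Column-range unipotent subgroups of `GL_n`: the groups `U_{[a,b]}`, their adelic points,
Tate boxes, Haar measures and the invariance of Haar measure under rational normalisers

Topic `NumberTheory/Automorphic`; namespace `Literature.NumberTheory.Automorphic`. Infrastructure for
the real-point Rankin–Selberg unfolding on `GL_n(𝔸_K)` (Jacquet–Shalika (1981), §4; Cogdell (2004),
§1.1 and §2.3), which runs through the tower of unipotent groups between `1` and `N_n`: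

  `U_{[a,b]} = {u ∈ N_n | u_{ij} = δ_{ij} unless a ≤ j ≤ b}`   (`0 ≤ a`, `b` natural numbers; columns
  of `Fin n` are compared through their values),

the upper unitriangular matrices whose non-trivial entries live in the columns `a, …, b`. For `a = 0`,
`b ≥ n - 1` this is `N_n`; `U_{[c, n-1]}` is the unipotent radical of the standard parabolic of type
`(c, 1, …, 1)` (the group `U^{(c)}` of the Whittaker recursion) and `U_{[c,c]} = Y_c ≅ 𝔾_a^{c}` is the
column group along which the `c`-th Fourier expansion is taken (Cogdell's `Y_n`, loc. cit. §1.1).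
Everything is proved:

* `unipotentColRange n R a b` (**definition**, any commutative ring): a subgroup of `GL_n(R)` contained
  in `upperUnitriangular` (closure under products and inverses is read off from `(u v)_{ij} = u_{ij}`,
  `(u⁻¹ u)_{ij} = (u⁻¹)_{ij}` for a column `j` outside `[a, b]`); entries outside the range
  (`apply_of_not_inColRange`), `unipotentColRange_le_upperUnitriangular`, monotonicity in the range,
  `unipotentColRange_eq_upperUnitriangular` (`a = 0`, `n ≤ b + 1`), naturality under ring maps.
* Over the adeles of a number field `K`: `adelicColRange n K a b ≤ GL_n(𝔸_K)` is a closed subgroup,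
  locally compact, Hausdorff, second countable (hence Polish); its rational points `rationalColRange`
  (a subgroup of it: the elements coming from `GL_n(K)`) are countable.
* `colRangeTateDomain n K a b` — **Tate's box** `{u | u_{ij} ∈ D for i < j}` (`D` Tate's additive
  fundamental domain of `K` in `𝔸_K`), and `existsUnique_smul_mem_colRangeTateDomain` — **every
  `u ∈ U_{[a,b]}(𝔸_K)` has exactly one left `U_{[a,b]}(K)`-translate in the box** (from the statement for
  `N_n`, `existsUnique_smul_mem_unipotentTateDomain`: the rational matrix produced there has its
  out-of-range entries in `D ∩ K = {0}`); hence the box is a measurable fundamental domain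
  (`isFundamentalDomain_colRangeTateDomain`) with compact closure and finite positive Haar measure.
* `isMulRightInvariant_of_isHaarMeasure_adelicColRange`, `isInvInvariant_of_isHaarMeasure_adelicColRange`
  — **`U_{[a,b]}(𝔸_K)` is unimodular** (it carries the lattice `U_{[a,b]}(K)`, `LatticeUnimodular`), so
  its Haar measures are inversion invariant (`isInvInvariant_of_isMulRightInvariant`);
  `lintegral_eq_setLIntegral_tsum_colRangeTateDomain` — unfolding an integral over `U_{[a,b]}(𝔸_K)` to
  the box.
* `colRangeConj` — conjugation by an element `g ∈ GL_n(𝔸_K)` normalising `U_{[a,b]}(𝔸_K)`, as a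
  topological automorphism of it, and `colRangeConj_mem_rationalColRange_iff` — a *rational* normaliser
  normalises the lattice `U_{[a,b]}(K)` (so that, by `Literature.MeasureTheory.Group.HaarCharLattice`,
  conjugation by it preserves the Haar measures of `U_{[a,b]}(𝔸_K)`; that consequence is drawn in the
  sequel, once the two files meet).

## References

* J. W. Cogdell, *Analytic theory of L-functions for GL_n*, in *An Introduction to the Langlands
  Program* (2004), §1.1 (the groups `P_n ⊃ Y_n`, `N_n`), §2.3 [CogdellAnalyticTheory2004].
* H. Jacquet, J. A. Shalika, *On Euler products and the classification of automorphic
  representations I*, Amer. J. Math. 103 (1981), §4 [JacquetShalikaAJM1981].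
* J. W. S. Cassels, A. Fröhlich (eds.), *Algebraic Number Theory* (1967), Ch. XV (Tate), Thm. 4.1.3
  [CasselsFrohlichANT1967].
-/

noncomputable section

open MeasureTheory Measure NumberField IsDedekindDomain Matrix Set
open scoped MatrixGroups ENNReal NNReal Pointwise

namespace Literature.NumberTheory.Automorphic

/-! ### The subgroups `U_{[a,b]}` over a commutative ring -/

section Ring

variable (n : ℕ) (R : Type*) [CommRing R] (a b : ℕ)

/-- A column index `j` is **in the range `[a, b]`**. [folklore] -/
def InColRange (a b : ℕ) (j : Fin n) : Prop := a ≤ (j : ℕ) ∧ (j : ℕ) ≤ b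

/-- Membership in a column range is decidable. [folklore] -/
instance instDecidableInColRange (a b : ℕ) (j : Fin n) : Decidable (InColRange n a b j) := by
  unfold InColRange; infer_instance

/-- **The column-range unipotent group `U_{[a,b]} ≤ GL_n(R)`**: upper unitriangular matrices `u` with
`u_{ij} = 0` for `i ≠ j` whenever the column `j` is outside `[a, b]` (Cogdell (2004), §1.1: for
`[a,b] = [c, n-1]` the unipotent radical of the parabolic of type `(c,1,…,1)`, for `a = b = c` the
column group `Y`). [folklore] -/
def unipotentColRange : Subgroup (GL (Fin n) R) where
  carrier := {u | u ∈ upperUnitriangular (Fin n) R ∧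
    ∀ i j : Fin n, i ≠ j → ¬ InColRange n a b j → (u : Matrix (Fin n) (Fin n) R) i j = 0}
  one_mem' := by
    refine ⟨(upperUnitriangular (Fin n) R).one_mem, fun i j hij _ => ?_⟩
    rw [Units.val_one, Matrix.one_apply_ne hij]
  mul_mem' := by
    rintro u v ⟨hu, hu'⟩ ⟨hv, hv'⟩
    refine ⟨(upperUnitriangular (Fin n) R).mul_mem hu hv, fun i j hij hj => ?_⟩
    obtain ⟨hvt, hvd⟩ := (mem_upperUnitriangular_iff v).1 hv
    -- `(u v)_{ij} = ∑_k u_{ik} v_{kj}` and `v_{kj} = δ_{kj}` in the column `j`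
    have hcol : ∀ k, (v : Matrix (Fin n) (Fin n) R) k j = if k = j then 1 else 0 := by
      intro k
      split_ifs with hk
      · subst hk; exact hvd k
      · exact hv' k j hk hj
    rw [Units.val_mul, Matrix.mul_apply]
    simp only [hcol, mul_ite, mul_one, mul_zero, Finset.sum_ite_eq', Finset.mem_univ, if_true]
    exact hu' i j hij hj
  inv_mem' := by
    rintro u ⟨hu, hu'⟩
    refine ⟨(upperUnitriangular (Fin n) R).inv_mem hu, fun i j hij hj => ?_⟩
    obtain ⟨hut, hud⟩ := (mem_upperUnitriangular_iff u).1 hu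
    have hcol : ∀ k, (u : Matrix (Fin n) (Fin n) R) k j = if k = j then 1 else 0 := by
      intro k
      split_ifs with hk
      · subst hk; exact hud k
      · exact hu' k j hk hj
    -- `(u⁻¹ u)_{ij} = (u⁻¹)_{ij}` and `u⁻¹ u = 1`
    have h1 : (((u⁻¹ : GL (Fin n) R) : Matrix (Fin n) (Fin n) R) * (u : Matrix (Fin n) (Fin n) R)) i j =
        ((u⁻¹ : GL (Fin n) R) : Matrix (Fin n) (Fin n) R) i j := by
      rw [Matrix.mul_apply]
      simp only [hcol, mul_ite, mul_one, mul_zero, Finset.sum_ite_eq', Finset.mem_univ, if_true]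
    have h2 : (((u⁻¹ : GL (Fin n) R) : Matrix (Fin n) (Fin n) R) * (u : Matrix (Fin n) (Fin n) R)) = 1 := by
      rw [← Units.val_mul, inv_mul_cancel, Units.val_one]
    rw [← h1, h2, Matrix.one_apply_ne hij]

variable {n R a b}

/-- Membership in `U_{[a,b]}`. [folklore] -/
theorem mem_unipotentColRange_iff {u : GL (Fin n) R} :
    u ∈ unipotentColRange n R a b ↔ u ∈ upperUnitriangular (Fin n) R ∧
      ∀ i j : Fin n, i ≠ j → ¬ InColRange n a b j → (u : Matrix (Fin n) (Fin n) R) i j = 0 :=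
  Iff.rfl

/-- `U_{[a,b]} ≤ N_n`. [folklore] -/
theorem unipotentColRange_le_upperUnitriangular :
    unipotentColRange n R a b ≤ upperUnitriangular (Fin n) R := fun _ hu => hu.1

/-- **Entries outside the range**: for `u ∈ U_{[a,b]}` and a column `j ∉ [a, b]`, `u_{ij} = δ_{ij}`.
[folklore] -/
theorem apply_of_not_inColRange {u : GL (Fin n) R} (hu : u ∈ unipotentColRange n R a b)
    (i : Fin n) {j : Fin n} (hj : ¬ InColRange n a b j) :
    (u : Matrix (Fin n) (Fin n) R) i j = if i = j then 1 else 0 := by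
  split_ifs with hij
  · subst hij
    exact ((mem_upperUnitriangular_iff u).1 hu.1).2 i
  · exact hu.2 i j hij hj

/-- Entries below the diagonal vanish, on the diagonal they are `1`. [folklore] -/
theorem apply_of_le {u : GL (Fin n) R} (hu : u ∈ unipotentColRange n R a b) {i j : Fin n}
    (hji : j ≤ i) : (u : Matrix (Fin n) (Fin n) R) i j = if i = j then 1 else 0 := by
  obtain ⟨hut, hud⟩ := (mem_upperUnitriangular_iff u).1 hu.1
  split_ifs with hij
  · subst hij; exact hud i
  · exact hut (lt_of_le_of_ne hji (Ne.symm hij))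

/-- A criterion for membership: upper unitriangular with prescribed vanishing above the diagonal in
the columns outside the range. [folklore] -/
theorem mem_unipotentColRange_of {u : GL (Fin n) R} (hu : u ∈ upperUnitriangular (Fin n) R)
    (h : ∀ i j : Fin n, i < j → ¬ InColRange n a b j → (u : Matrix (Fin n) (Fin n) R) i j = 0) :
    u ∈ unipotentColRange n R a b := by
  refine ⟨hu, fun i j hij hj => ?_⟩
  rcases lt_or_gt_of_ne hij with hlt | hgt
  · exact h i j hlt hj
  · exact ((mem_upperUnitriangular_iff u).1 hu).1 hgt

/-- **Monotonicity in the range**: `[a, b] ⊆ [a', b']` gives `U_{[a,b]} ≤ U_{[a',b']}`. [folklore] -/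
theorem unipotentColRange_mono {a' b' : ℕ} (ha : a' ≤ a) (hb : b ≤ b') :
    unipotentColRange n R a b ≤ unipotentColRange n R a' b' := by
  intro u hu
  refine ⟨hu.1, fun i j hij hj => hu.2 i j hij fun h => hj ⟨ha.trans h.1, h.2.trans hb⟩⟩

/-- **The full range is `N_n`**: `U_{[0,b]} = N_n` as soon as `n ≤ b + 1`. [folklore] -/
theorem unipotentColRange_eq_upperUnitriangular (hb : n ≤ b + 1) :
    unipotentColRange n R 0 b = upperUnitriangular (Fin n) R := by
  refine le_antisymm unipotentColRange_le_upperUnitriangular fun u hu => ⟨hu, fun i j _ hj => ?_⟩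
  exact (hj ⟨Nat.zero_le _, by have := j.2; omega⟩).elim

/-- **The empty range is trivial**: `U_{[a,b]} = 1` if no column of `Fin n` lies in `[a, b]`.
[folklore] -/
theorem unipotentColRange_eq_bot (h : ∀ j : Fin n, ¬ InColRange n a b j) :
    unipotentColRange n R a b = ⊥ := by
  refine (Subgroup.eq_bot_iff_forall _).2 fun u hu => ?_
  refine Units.ext (Matrix.ext fun i j => ?_)
  rw [apply_of_not_inColRange hu i (h j), Units.val_one, Matrix.one_apply]

/-- **Naturality**: a ring homomorphism maps `U_{[a,b]}(R)` into `U_{[a,b]}(S)`. [folklore] -/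
theorem map_mem_unipotentColRange {S : Type*} [CommRing S] (f : R →+* S) {u : GL (Fin n) R}
    (hu : u ∈ unipotentColRange n R a b) :
    Matrix.GeneralLinearGroup.map f u ∈ unipotentColRange n S a b := by
  obtain ⟨hut, hud⟩ := (mem_upperUnitriangular_iff u).1 hu.1
  refine ⟨(mem_upperUnitriangular_iff _).2 ⟨fun i j hij => ?_, fun i => ?_⟩, fun i j hij hj => ?_⟩
  · change f ((u : Matrix (Fin n) (Fin n) R) i j) = 0
    rw [hut hij, map_zero]
  · change f ((u : Matrix (Fin n) (Fin n) R) i i) = 1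
    rw [hud i, map_one]
  · change f ((u : Matrix (Fin n) (Fin n) R) i j) = 0
    rw [hu.2 i j hij hj, map_zero]

end Ring

/-! ### The adelic groups `U_{[a,b]}(𝔸_K)` and their rational points -/

section Adelic

variable (n : ℕ) (K : Type) [Field K] [NumberField K] (a b : ℕ)

/-- `U_{[a,b]}(𝔸_K) ≤ GL_n(𝔸_K)`. [folklore] -/
abbrev adelicColRange : Subgroup (GL (Fin n) (AdeleRing (𝓞 K) K)) :=
  unipotentColRange n (AdeleRing (𝓞 K) K) a b

/-- `U_{[a,b]}(𝔸_K) ≤ N_n(𝔸_K)`. [folklore] -/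
theorem adelicColRange_le_adelicUnipotent : adelicColRange n K a b ≤ adelicUnipotent n K :=
  unipotentColRange_le_upperUnitriangular

/-- **The rational points `U_{[a,b]}(K)`**: the elements of `U_{[a,b]}(𝔸_K)` lying in the arithmetic
subgroup `GL_n(K)` (diagonally embedded), as a subgroup of `U_{[a,b]}(𝔸_K)` (cf. `rationalUnipotent`).
[folklore] -/
def rationalColRange : Subgroup ↥(adelicColRange n K a b) :=
  ((AdelicGroupData.gl n K).arithmeticSubgroup).comap (adelicColRange n K a b).subtype

variable {n K a b}

/-- Membership in `rationalColRange`: the element is the diagonal image of a rational matrix.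
[folklore] -/
theorem mem_rationalColRange_iff (u : ↥(adelicColRange n K a b)) :
    u ∈ rationalColRange n K a b ↔
      ∃ γ : GL (Fin n) K, Matrix.GeneralLinearGroup.map (algebraMap K (AdeleRing (𝓞 K) K)) γ = u :=
  Iff.rfl

/-- The inclusion `U_{[a,b]}(𝔸_K) ↪ N_n(𝔸_K)` on elements. [folklore] -/
def toAdelicUnipotent (u : ↥(adelicColRange n K a b)) : ↥(adelicUnipotent n K) :=
  ⟨u, adelicColRange_le_adelicUnipotent n K a b u.2⟩

/-- The inclusion does not change the underlying matrix. [folklore] -/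
@[simp]
theorem coe_toAdelicUnipotent (u : ↥(adelicColRange n K a b)) :
    ((toAdelicUnipotent u : ↥(adelicUnipotent n K)) : GL (Fin n) (AdeleRing (𝓞 K) K)) = u := rfl

variable (n K a b)

/-- `U_{[a,b]}(K)` is countable (it injects into the countable `GL_n(K)`,
`countable_generalLinearGroup_numberField`). [folklore] -/
instance countable_rationalColRange : Countable ↥(rationalColRange n K a b) := by
  haveI := countable_generalLinearGroup_numberField n K
  set f := (Matrix.GeneralLinearGroup.map (algebraMap K (AdeleRing (𝓞 K) K)) : GL (Fin n) K → _)
  have hrange : ∀ γ : ↥(rationalColRange n K a b),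
      ((γ : ↥(adelicColRange n K a b)) : GL (Fin n) (AdeleRing (𝓞 K) K)) ∈ range f := by
    intro γ
    obtain ⟨g, hg⟩ := (mem_rationalColRange_iff (γ : ↥(adelicColRange n K a b))).1 γ.2
    exact ⟨g, hg⟩
  haveI : Countable (range f) := (countable_range f).to_subtype
  refine Function.Injective.countable (f := fun γ : ↥(rationalColRange n K a b) =>
    (⟨_, hrange γ⟩ : range f)) fun x y h => ?_
  have h' := congrArg Subtype.val h
  exact Subtype.ext (Subtype.ext h')

/-- **`U_{[a,b]}(𝔸_K)` is closed in `GL_n(𝔸_K)`** (`N_n(𝔸_K)` is closed and the extra conditions are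
zero sets of continuous entries). [folklore] -/
theorem isClosed_adelicColRange :
    IsClosed ((adelicColRange n K a b : Subgroup (GL (Fin n) (AdeleRing (𝓞 K) K))) :
      Set (GL (Fin n) (AdeleRing (𝓞 K) K))) := by
  haveI := t2Space_adeleRing K
  have e : ((adelicColRange n K a b : Subgroup (GL (Fin n) (AdeleRing (𝓞 K) K))) :
      Set (GL (Fin n) (AdeleRing (𝓞 K) K))) =
      (adelicUnipotent n K : Set (GL (Fin n) (AdeleRing (𝓞 K) K))) ∩
        ⋂ i : Fin n, ⋂ j : Fin n, {u : GL (Fin n) (AdeleRing (𝓞 K) K) |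
          i ≠ j → ¬ InColRange n a b j → (u : Matrix (Fin n) (Fin n) (AdeleRing (𝓞 K) K)) i j = 0} := by
    ext u
    simp only [SetLike.mem_coe, mem_unipotentColRange_iff, Set.mem_inter_iff, Set.mem_iInter,
      Set.mem_setOf_eq]
  rw [e]
  refine (isClosed_adelicUnipotent n K).inter (isClosed_iInter fun i => isClosed_iInter fun j => ?_)
  by_cases hij : i ≠ j ∧ ¬ InColRange n a b j
  · have : {u : GL (Fin n) (AdeleRing (𝓞 K) K) | i ≠ j → ¬ InColRange n a b j →
        (u : Matrix (Fin n) (Fin n) (AdeleRing (𝓞 K) K)) i j = 0} =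
        {u : GL (Fin n) (AdeleRing (𝓞 K) K) | (u : Matrix (Fin n) (Fin n) (AdeleRing (𝓞 K) K)) i j = 0} := by
      ext u
      simp only [Set.mem_setOf_eq]
      exact ⟨fun h => h hij.1 hij.2, fun h _ _ => h⟩
    rw [this]
    exact isClosed_eq (Units.continuous_val.matrix_elem i j) continuous_const
  · have : {u : GL (Fin n) (AdeleRing (𝓞 K) K) | i ≠ j → ¬ InColRange n a b j →
        (u : Matrix (Fin n) (Fin n) (AdeleRing (𝓞 K) K)) i j = 0} = Set.univ := by
      ext u
      simp only [Set.mem_setOf_eq, Set.mem_univ, iff_true]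
      intro h1 h2
      exact (hij ⟨h1, h2⟩).elim
    rw [this]
    exact isClosed_univ

/-- `U_{[a,b]}(𝔸_K)` is Hausdorff. [folklore] -/
instance t2Space_adelicColRange : T2Space ↥(adelicColRange n K a b) := by
  haveI := t2Space_adeleRing K
  infer_instance

/-- `U_{[a,b]}(𝔸_K)` is locally compact (closed in the locally compact `GL_n(𝔸_K)`). [folklore] -/
instance locallyCompactSpace_adelicColRange : LocallyCompactSpace ↥(adelicColRange n K a b) := by
  haveI := AdelicGroupData.locallyCompactSpace_generalLinearGroup_adeleRing K (Fin n)
  exact (isClosed_adelicColRange n K a b).isClosedEmbedding_subtypeVal.locallyCompactSpace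

/-- `U_{[a,b]}(𝔸_K)` is second countable. [folklore] -/
instance secondCountableTopology_adelicColRange :
    SecondCountableTopology ↥(adelicColRange n K a b) := by
  haveI := secondCountableTopology_generalLinearGroup_adeleRing K (Fin n)
  exact TopologicalSpace.Subtype.secondCountableTopology _

/-- `U_{[a,b]}(𝔸_K)` is a Polish space (locally compact, second countable, Hausdorff), hence
(pseudo)metrizable — so that its Haar measures are regular. [folklore] -/
instance polishSpace_adelicColRange : PolishSpace ↥(adelicColRange n K a b) :=
  Literature.Topology.Metrizable.polishSpace_of_locallyCompactSpace_of_secondCountableTopology _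

variable {n K a b}

/-- The entries are continuous on `U_{[a,b]}(𝔸_K)`. [folklore] -/
theorem continuous_adelicColRange_apply (i j : Fin n) :
    Continuous fun u : ↥(adelicColRange n K a b) =>
      ((u : GL (Fin n) (AdeleRing (𝓞 K) K)) : Matrix (Fin n) (Fin n) (AdeleRing (𝓞 K) K)) i j :=
  (Units.continuous_val.comp continuous_subtype_val).matrix_elem i j

/-- The inclusion into `N_n(𝔸_K)` is continuous. [folklore] -/
theorem continuous_toAdelicUnipotent :
    Continuous (toAdelicUnipotent : ↥(adelicColRange n K a b) → ↥(adelicUnipotent n K)) :=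
  continuous_subtype_val.subtype_mk _

/-- The inclusion into `N_n(𝔸_K)` is a closed embedding (both groups are closed in `GL_n(𝔸_K)`).
[folklore] -/
theorem isClosedEmbedding_toAdelicUnipotent :
    Topology.IsClosedEmbedding
      (toAdelicUnipotent : ↥(adelicColRange n K a b) → ↥(adelicUnipotent n K)) := by
  have h1 : Topology.IsClosedEmbedding ((↑) : ↥(adelicUnipotent n K) → GL (Fin n) (AdeleRing (𝓞 K) K)) :=
    (isClosed_adelicUnipotent n K).isClosedEmbedding_subtypeVal
  have h2 : Topology.IsClosedEmbedding
      (((↑) : ↥(adelicUnipotent n K) → GL (Fin n) (AdeleRing (𝓞 K) K)) ∘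
        (toAdelicUnipotent : ↥(adelicColRange n K a b) → ↥(adelicUnipotent n K))) :=
    (isClosed_adelicColRange n K a b).isClosedEmbedding_subtypeVal
  exact (Topology.IsClosedEmbedding.of_comp_iff h1).mp h2

/-! ### Tate's box and unique representability modulo `U_{[a,b]}(K)` -/

variable (n K a b)

/-- **Tate's box in `U_{[a,b]}(𝔸_K)`**: the elements all of whose entries above the diagonal lie in
Tate's additive fundamental domain `D` of `K` in `𝔸_K` (the out-of-range entries vanish and `0 ∈ D`,
so this is the trace of the box `𝓕_N` of `N_n(𝔸_K)`, `unipotentTateDomain`).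
[cite: CasselsFrohlichANT1967, Ch. XV Def. 4.1.2 and Thm. 4.1.3] -/
def colRangeTateDomain : Set ↥(adelicColRange n K a b) :=
  {u | ∀ i j : Fin n, i < j →
    ((u : GL (Fin n) (AdeleRing (𝓞 K) K)) : Matrix (Fin n) (Fin n) (AdeleRing (𝓞 K) K)) i j ∈
      adeleFundamentalDomain K}

variable {n K a b}

/-- Membership in the box (definitional). [folklore] -/
theorem mem_colRangeTateDomain_iff {u : ↥(adelicColRange n K a b)} :
    u ∈ colRangeTateDomain n K a b ↔ ∀ i j : Fin n, i < j →
      ((u : GL (Fin n) (AdeleRing (𝓞 K) K)) : Matrix (Fin n) (Fin n) (AdeleRing (𝓞 K) K)) i j ∈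
        adeleFundamentalDomain K :=
  Iff.rfl

/-- The box is the preimage of the box `𝓕_N` of `N_n(𝔸_K)`. [folklore] -/
theorem colRangeTateDomain_eq_preimage :
    colRangeTateDomain n K a b = toAdelicUnipotent ⁻¹' unipotentTateDomain n K := rfl

/-- `1` lies in the box. [folklore] -/
theorem one_mem_colRangeTateDomain : (1 : ↥(adelicColRange n K a b)) ∈ colRangeTateDomain n K a b := by
  rw [colRangeTateDomain_eq_preimage, Set.mem_preimage]
  exact one_mem_unipotentTateDomain

/-- **`D ∩ K = {0}`**: a principal adele lies in Tate's fundamental domain only if it is zero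
(uniqueness in `existsUnique_add_algebraMap_mem_adeleFundamentalDomain` at `x = 0`, and `0 ∈ D`).
[folklore] -/
theorem algebraMap_mem_adeleFundamentalDomain_iff (ξ : K) :
    algebraMap K (AdeleRing (𝓞 K) K) ξ ∈ adeleFundamentalDomain K ↔ ξ = 0 := by
  constructor
  · intro h
    obtain ⟨ξ₀, -, huniq⟩ := existsUnique_add_algebraMap_mem_adeleFundamentalDomain K 0
    have h1 : ξ = ξ₀ := huniq ξ (by simp only [add_zero]; exact h)
    have h2 : (0 : K) = ξ₀ :=
      huniq 0 (by simp only [map_zero, add_zero]; exact zero_mem_adeleFundamentalDomain K)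
    rw [h1, ← h2]
  · rintro rfl
    rw [map_zero]
    exact zero_mem_adeleFundamentalDomain K

/-- **The rational translate landing in the box is in `U_{[a,b]}(K)`.** If `u ∈ U_{[a,b]}(𝔸_K)` and
`γ ∈ N_n(K)` satisfies `γ u ∈ 𝓕_N`, then the out-of-range entries of `γ` vanish: for a column `j`
outside `[a, b]` and `i < j`, `(γ u)_{ij} = γ_{ij}` (the column `j` of `u` is trivial), a principal
adele lying in `D`, hence zero. [folklore] -/
theorem mem_adelicColRange_of_smul_mem {u : ↥(adelicColRange n K a b)} {γ : ↥(rationalUnipotent n K)}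
    (h : γ • toAdelicUnipotent u ∈ unipotentTateDomain n K) :
    ((γ : ↥(adelicUnipotent n K)) : GL (Fin n) (AdeleRing (𝓞 K) K)) ∈ adelicColRange n K a b := by
  obtain ⟨g, hg⟩ := (mem_rationalUnipotent_iff (γ : ↥(adelicUnipotent n K))).1 γ.2
  have hγN := (γ : ↥(adelicUnipotent n K)).2
  refine mem_unipotentColRange_of hγN fun i j hij hj => ?_
  -- the entry `(γ u)_{ij}`
  have hent := (mem_unipotentTateDomain_iff.1 h) i j hij
  have hmul : (((γ • toAdelicUnipotent u : ↥(adelicUnipotent n K)) : GL (Fin n) (AdeleRing (𝓞 K) K)) :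
      Matrix (Fin n) (Fin n) (AdeleRing (𝓞 K) K)) i j =
      (((γ : ↥(adelicUnipotent n K)) : GL (Fin n) (AdeleRing (𝓞 K) K)) :
        Matrix (Fin n) (Fin n) (AdeleRing (𝓞 K) K)) i j := by
    rw [Subgroup.smul_def, smul_eq_mul, Subgroup.coe_mul, coe_toAdelicUnipotent, Units.val_mul,
      Matrix.mul_apply]
    have hcol : ∀ k, ((u : GL (Fin n) (AdeleRing (𝓞 K) K)) :
        Matrix (Fin n) (Fin n) (AdeleRing (𝓞 K) K)) k j = if k = j then 1 else 0 :=
      fun k => apply_of_not_inColRange u.2 k hj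
    simp only [hcol, mul_ite, mul_one, mul_zero, Finset.sum_ite_eq', Finset.mem_univ, if_true]
  rw [hmul] at hent
  -- it is the principal adele `g i j`
  have hγij : (((γ : ↥(adelicUnipotent n K)) : GL (Fin n) (AdeleRing (𝓞 K) K)) :
      Matrix (Fin n) (Fin n) (AdeleRing (𝓞 K) K)) i j =
      algebraMap K (AdeleRing (𝓞 K) K) ((g : Matrix (Fin n) (Fin n) K) i j) := by
    rw [← hg]; rfl
  rw [hγij] at hent ⊢
  rw [(algebraMap_mem_adeleFundamentalDomain_iff _).1 hent, map_zero]

/-- The lift of a rational element of `N_n(𝔸_K)` lying in `U_{[a,b]}(𝔸_K)` to `rationalColRange`.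
[folklore] -/
def liftRational (γ : ↥(rationalUnipotent n K))
    (hγ : ((γ : ↥(adelicUnipotent n K)) : GL (Fin n) (AdeleRing (𝓞 K) K)) ∈ adelicColRange n K a b) :
    ↥(rationalColRange n K a b) :=
  ⟨⟨((γ : ↥(adelicUnipotent n K)) : GL (Fin n) (AdeleRing (𝓞 K) K)), hγ⟩, γ.2⟩

/-- `liftRational` does not change the underlying matrix. [folklore] -/
@[simp]
theorem coe_coe_liftRational (γ : ↥(rationalUnipotent n K))
    (hγ : ((γ : ↥(adelicUnipotent n K)) : GL (Fin n) (AdeleRing (𝓞 K) K)) ∈ adelicColRange n K a b) :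
    (((liftRational γ hγ : ↥(rationalColRange n K a b)) : ↥(adelicColRange n K a b)) :
      GL (Fin n) (AdeleRing (𝓞 K) K)) = ((γ : ↥(adelicUnipotent n K)) : GL (Fin n) (AdeleRing (𝓞 K) K)) :=
  rfl

/-- The descent of an element of `rationalColRange` to `rationalUnipotent`. [folklore] -/
def toRationalUnipotent (γ : ↥(rationalColRange n K a b)) : ↥(rationalUnipotent n K) :=
  ⟨toAdelicUnipotent (γ : ↥(adelicColRange n K a b)), γ.2⟩

/-- `toRationalUnipotent` does not change the underlying matrix. [folklore] -/
@[simp]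
theorem coe_coe_toRationalUnipotent (γ : ↥(rationalColRange n K a b)) :
    (((toRationalUnipotent γ : ↥(rationalUnipotent n K)) : ↥(adelicUnipotent n K)) :
      GL (Fin n) (AdeleRing (𝓞 K) K)) = ((γ : ↥(adelicColRange n K a b)) : GL (Fin n) (AdeleRing (𝓞 K) K)) :=
  rfl

/-- Translates commute with the inclusion into `N_n(𝔸_K)`. [folklore] -/
theorem toAdelicUnipotent_smul (γ : ↥(rationalColRange n K a b)) (u : ↥(adelicColRange n K a b)) :
    toAdelicUnipotent (γ • u) = toRationalUnipotent γ • toAdelicUnipotent u :=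
  rfl

/-- **Tate's Theorem 4.1.3 (1) for `U_{[a,b]}`**: every `u ∈ U_{[a,b]}(𝔸_K)` has exactly one left
`U_{[a,b]}(K)`-translate in the box (from `existsUnique_smul_mem_unipotentTateDomain` and
`mem_adelicColRange_of_smul_mem`). [cite: CasselsFrohlichANT1967, Ch. XV Thm. 4.1.3 (1)] -/
theorem existsUnique_smul_mem_colRangeTateDomain (u : ↥(adelicColRange n K a b)) :
    ∃! γ : ↥(rationalColRange n K a b), γ • u ∈ colRangeTateDomain n K a b := by
  obtain ⟨γ₀, hγ₀, huniq⟩ := existsUnique_smul_mem_unipotentTateDomain (toAdelicUnipotent u)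
  have hmem := mem_adelicColRange_of_smul_mem hγ₀
  refine ⟨liftRational γ₀ hmem, ?_, fun γ hγ => ?_⟩
  · change toAdelicUnipotent (liftRational γ₀ hmem • u) ∈ unipotentTateDomain n K
    rw [toAdelicUnipotent_smul]
    exact hγ₀
  · change toAdelicUnipotent (γ • u) ∈ unipotentTateDomain n K at hγ
    rw [toAdelicUnipotent_smul] at hγ
    have h1 : toRationalUnipotent γ = γ₀ := huniq _ hγ
    refine Subtype.ext (Subtype.ext ?_)
    rw [coe_coe_liftRational, ← h1, coe_coe_toRationalUnipotent]

/-- The closure of the box is compact (it is a closed subset of the preimage of the compact closure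
of `𝓕_N` under the closed embedding into `N_n(𝔸_K)`). [folklore] -/
theorem isCompact_closure_colRangeTateDomain : IsCompact (closure (colRangeTateDomain n K a b)) := by
  have h1 : IsCompact (toAdelicUnipotent ⁻¹' closure (unipotentTateDomain n K) :
      Set ↥(adelicColRange n K a b)) :=
    isClosedEmbedding_toAdelicUnipotent.isCompact_preimage isCompact_closure_unipotentTateDomain
  refine h1.of_isClosed_subset isClosed_closure ?_
  rw [colRangeTateDomain_eq_preimage]
  exact (continuous_toAdelicUnipotent.closure_preimage_subset _)

/-! ### Measure-theoretic properties: fundamental domain, Haar measure, unimodularity -/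

section Measure

variable [MeasurableSpace (GL (Fin n) (AdeleRing (𝓞 K) K))] [BorelSpace (GL (Fin n) (AdeleRing (𝓞 K) K))]

/-- The box is a Borel set (continuous entries, `D` Borel). [folklore] -/
theorem measurableSet_colRangeTateDomain : MeasurableSet (colRangeTateDomain n K a b) := by
  borelize (AdeleRing (𝓞 K) K)
  have : colRangeTateDomain n K a b = ⋂ i : Fin n, ⋂ j : Fin n, ⋂ (_ : i < j),
      (fun u : ↥(adelicColRange n K a b) =>
        ((u : GL (Fin n) (AdeleRing (𝓞 K) K)) : Matrix (Fin n) (Fin n) (AdeleRing (𝓞 K) K)) i j) ⁻¹'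
        adeleFundamentalDomain K := by
    ext u
    simp only [mem_colRangeTateDomain_iff, mem_iInter, mem_preimage]
  rw [this]
  exact MeasurableSet.iInter fun i => MeasurableSet.iInter fun j => MeasurableSet.iInter fun _ =>
    (continuous_adelicColRange_apply i j).measurable (measurableSet_adeleFundamentalDomain K)

/-- **The box is a measurable fundamental domain** for the left multiplication action of
`U_{[a,b]}(K)` on `U_{[a,b]}(𝔸_K)`, with respect to every measure (`IsFundamentalDomain.mk'`).
[cite: CasselsFrohlichANT1967, Ch. XV Thm. 4.1.3 (1)] -/
theorem isFundamentalDomain_colRangeTateDomain (ν : Measure ↥(adelicColRange n K a b)) :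
    IsFundamentalDomain ↥(rationalColRange n K a b) (colRangeTateDomain n K a b) ν :=
  IsFundamentalDomain.mk' measurableSet_colRangeTateDomain.nullMeasurableSet
    existsUnique_smul_mem_colRangeTateDomain

omit [BorelSpace (GL (Fin n) (AdeleRing (𝓞 K) K))] in
/-- `ν(box) < ∞` for every measure finite on compact sets. [folklore] -/
theorem measure_colRangeTateDomain_lt_top (ν : Measure ↥(adelicColRange n K a b))
    [IsFiniteMeasureOnCompacts ν] : ν (colRangeTateDomain n K a b) < ⊤ :=
  (measure_mono subset_closure).trans_lt isCompact_closure_colRangeTateDomain.measure_lt_top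

/-- `0 < ν(box)` for every non-zero `U_{[a,b]}(K)`-invariant measure, in particular for every Haar
measure. [folklore] -/
theorem measure_colRangeTateDomain_pos (ν : Measure ↥(adelicColRange n K a b))
    [SMulInvariantMeasure ↥(rationalColRange n K a b) ↥(adelicColRange n K a b) ν] (hν : ν ≠ 0) :
    0 < ν (colRangeTateDomain n K a b) :=
  pos_iff_ne_zero.2 ((isFundamentalDomain_colRangeTateDomain ν).measure_ne_zero hν)

/-- A Haar measure gives the box positive measure. [folklore] -/
theorem measure_colRangeTateDomain_pos_of_isHaarMeasure (ν : Measure ↥(adelicColRange n K a b))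
    [IsHaarMeasure ν] : 0 < ν (colRangeTateDomain n K a b) := by
  refine measure_colRangeTateDomain_pos ν fun h => ?_
  have := isOpen_univ.measure_ne_zero ν univ_nonempty
  rw [h] at this
  exact this rfl

/-- **`U_{[a,b]}(𝔸_K)` is unimodular**: every Haar measure is right invariant (it carries the lattice
`U_{[a,b]}(K)` with the box as fundamental domain of finite positive measure; `LatticeUnimodular`).
[folklore] -/
theorem isMulRightInvariant_of_isHaarMeasure_adelicColRange (ν : Measure ↥(adelicColRange n K a b))
    [IsHaarMeasure ν] : ν.IsMulRightInvariant :=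
  isMulRightInvariant_of_isFundamentalDomain (rationalColRange n K a b) ν
    (isFundamentalDomain_colRangeTateDomain ν)
    (measure_colRangeTateDomain_pos_of_isHaarMeasure ν).ne'
    (measure_colRangeTateDomain_lt_top ν).ne

/-- Hence **Haar measures on `U_{[a,b]}(𝔸_K)` are inversion invariant**
(`isInvInvariant_of_isMulRightInvariant`). [folklore] -/
theorem isInvInvariant_of_isHaarMeasure_adelicColRange (ν : Measure ↥(adelicColRange n K a b))
    [IsHaarMeasure ν] : ν.IsInvInvariant := by
  haveI := isMulRightInvariant_of_isHaarMeasure_adelicColRange ν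
  exact isInvInvariant_of_isMulRightInvariant ν

/-- The inversion-invariance in integrated form: `∫ f(u⁻¹) dν = ∫ f dν` for measurable `f ≥ 0` (the
hypothesis `hinv` of the `Γ · U` independence lemma of `CoveringWeights`). [folklore] -/
theorem lintegral_inv_eq_of_isHaarMeasure_adelicColRange (ν : Measure ↥(adelicColRange n K a b))
    [IsHaarMeasure ν] {f : ↥(adelicColRange n K a b) → ℝ≥0∞} (hf : Measurable f) :
    ∫⁻ u, f u⁻¹ ∂ν = ∫⁻ u, f u ∂ν := by
  haveI := isInvInvariant_of_isHaarMeasure_adelicColRange ν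
  have h := (measurePreserving_inv ν).lintegral_comp hf
  exact h

/-- **Unfolding over the lattice**: for a `U_{[a,b]}(K)`-invariant measure `ν` and measurable `f ≥ 0`,
`∫ f dν = ∫_{box} Σ_{γ ∈ U_{[a,b]}(K)} f(γ u) dν(u)` (Mathlib `IsFundamentalDomain.lintegral_eq_tsum''`-type
statement for the box). [folklore] -/
theorem lintegral_eq_setLIntegral_tsum_colRangeTateDomain (ν : Measure ↥(adelicColRange n K a b))
    [SMulInvariantMeasure ↥(rationalColRange n K a b) ↥(adelicColRange n K a b) ν]
    (f : ↥(adelicColRange n K a b) → ℝ≥0∞) (hf : Measurable f) :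
    ∫⁻ u, f u ∂ν = ∫⁻ u in colRangeTateDomain n K a b, ∑' γ : ↥(rationalColRange n K a b), f (γ • u) ∂ν := by
  have h := (isFundamentalDomain_colRangeTateDomain ν).lintegral_eq_tsum'' f
  rw [h, lintegral_tsum]
  exact fun γ => ((hf.comp (measurable_const_smul _)).aemeasurable).restrict

end Measure

/-! ### Conjugation by normalising elements and the invariance of Haar measure -/

section Conj

/-- **Conjugation by an element of `GL_n(𝔸_K)` normalising `U_{[a,b]}(𝔸_K)`**, as a topological
group automorphism `u ↦ g u g⁻¹` of `U_{[a,b]}(𝔸_K)`. [folklore] -/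
def colRangeConj (g : GL (Fin n) (AdeleRing (𝓞 K) K))
    (hg : ∀ u : GL (Fin n) (AdeleRing (𝓞 K) K), u ∈ adelicColRange n K a b ↔
      g * u * g⁻¹ ∈ adelicColRange n K a b) :
    ↥(adelicColRange n K a b) ≃ₜ* ↥(adelicColRange n K a b) where
  toFun u := ⟨g * u * g⁻¹, (hg u).1 u.2⟩
  invFun u := ⟨g⁻¹ * u * g, by
    have h := (hg (g⁻¹ * u * g)).2
    rw [show g * (g⁻¹ * (u : GL (Fin n) (AdeleRing (𝓞 K) K)) * g) * g⁻¹ = u by group] at h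
    exact h u.2⟩
  left_inv u := Subtype.ext (by change g⁻¹ * (g * (u : GL (Fin n) (AdeleRing (𝓞 K) K)) * g⁻¹) * g = u; group)
  right_inv u := Subtype.ext (by change g * (g⁻¹ * (u : GL (Fin n) (AdeleRing (𝓞 K) K)) * g) * g⁻¹ = u; group)
  map_mul' u v := Subtype.ext (by
    change g * ((u : GL (Fin n) (AdeleRing (𝓞 K) K)) * v) * g⁻¹ =
      g * (u : GL (Fin n) (AdeleRing (𝓞 K) K)) * g⁻¹ * (g * v * g⁻¹)
    group)
  continuous_toFun := by
    refine Continuous.subtype_mk ?_ _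
    exact (continuous_const.mul continuous_subtype_val).mul continuous_const
  continuous_invFun := by
    refine Continuous.subtype_mk ?_ _
    exact (continuous_const.mul continuous_subtype_val).mul continuous_const

/-- The underlying matrix of `colRangeConj g hg u` is `g u g⁻¹`. [folklore] -/
@[simp]
theorem coe_colRangeConj_apply (g : GL (Fin n) (AdeleRing (𝓞 K) K))
    (hg : ∀ u : GL (Fin n) (AdeleRing (𝓞 K) K), u ∈ adelicColRange n K a b ↔
      g * u * g⁻¹ ∈ adelicColRange n K a b) (u : ↥(adelicColRange n K a b)) :
    ((colRangeConj g hg u : ↥(adelicColRange n K a b)) : GL (Fin n) (AdeleRing (𝓞 K) K)) =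
      g * u * g⁻¹ := rfl

/-- **A rational normaliser normalises the lattice**: if `g` is the diagonal image of a rational
matrix normalising `U_{[a,b]}(𝔸_K)`, then conjugation by `g` maps `U_{[a,b]}(K)` onto itself.
[folklore] -/
theorem colRangeConj_mem_rationalColRange_iff {g₀ : GL (Fin n) K}
    (hg : ∀ u : GL (Fin n) (AdeleRing (𝓞 K) K), u ∈ adelicColRange n K a b ↔
      Matrix.GeneralLinearGroup.map (algebraMap K (AdeleRing (𝓞 K) K)) g₀ * u *
        (Matrix.GeneralLinearGroup.map (algebraMap K (AdeleRing (𝓞 K) K)) g₀)⁻¹ ∈ adelicColRange n K a b)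
    (u : ↥(adelicColRange n K a b)) :
    colRangeConj _ hg u ∈ rationalColRange n K a b ↔ u ∈ rationalColRange n K a b := by
  set g := Matrix.GeneralLinearGroup.map (algebraMap K (AdeleRing (𝓞 K) K)) g₀ with hgdef
  rw [mem_rationalColRange_iff, mem_rationalColRange_iff, coe_colRangeConj_apply]
  constructor
  · rintro ⟨γ, hγ⟩
    refine ⟨g₀⁻¹ * γ * g₀, ?_⟩
    rw [map_mul, map_mul, map_inv, hγ, ← hgdef]
    group
  · rintro ⟨γ, hγ⟩
    refine ⟨g₀ * γ * g₀⁻¹, ?_⟩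
    rw [map_mul, map_mul, map_inv, hγ, ← hgdef]

end Conj

end Adelic

end Literature.NumberTheory.Automorphic
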